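import Summits.CriticalPhenomena.Ising3DConformalLimit.Theorems.EnergyNotSigmaSquaredGapForcesFarMergingSandwichDefs
import Summits.CriticalPhenomena.Ising3DConformalLimit.Theorems.EnergyNotSigmaSquaredGapForcesFarMergingScreeningFarMerging
import Literature.Probability.LatticeModels.SourcedDoubleCurrentsSwitching
import Literature.Probability.LatticeModels.CriticalUrsellFourSign
import Literature.Probability.LatticeModels.CriticalCorrWellDefined
import HarnessLib

/-! # Far two-current merging is far merging of spins (line `one-cluster-depletion-sandwich` of crux
`GapForcesFarMerging`, item stmt-CriticalPhenomena-4468; stub `stub_farMergingSpins`)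

The exact far end of the line: `FarMergeIO → FarMerging`.

Route. `FarMergeIO` gives `c > 0`, an injective shape `y` and, for every `L₀`, a scale `L ≥ L₀` with
two-current merging probability `merge n (L • y) = P^{z₀z₁,z₂z₃}_{Λ_n}[z₂ ∈ C_{n₁+n₂}(z₀)] ≥ c` for
infinitely many box sizes `n` (`z = L • y`). The merging event `{z₂ ∈ C_{n₁+n₂}(z₀)}` is the tree's
`openConn z₀ z₂` (definitionally), so for `n` large (all four points in `Λ_n = box 3 n`) ADC21 (3.11) in
the box (`connectedFour_free_box_eq`) reads `U₄^{Λ_n}(z) = -2 G_n(z₀,z₁) G_n(z₂,z₃) · merge n z`, whence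
`U₄^{Λ_n}(z) + 2c G_n G_n ≤ 0` frequently in `n` (Griffiths I: `G_n ≥ 0`). The box quantities converge
(`tendsto_connectedFour_box_criticalBeta`, `tendsto_isingTwoPoint_box_criticalCorr_two`), and a convergent
real sequence which is `≤ 0` frequently has limit `≤ 0`; this is the far-merging inequality with constant
`2c` along the same shape `y`. (Same argument as the sibling `stub_farMerging` of line
`screening-form-lemma-a1`, minus the screening dictionary.)

References: Aizenman–Duminil-Copin 2021, §3 (3.11)–(3.12); Aizenman 1982 Prop. 5.3.
-/

noncomputable section

namespace Summit.CriticalPhenomena.Ising3DConformalLimit.EnergyNotSigmaSquaredGapForcesFarMergingSandwich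

namespace FarMergingSpinsProof

open scoped symmDiff ENNReal Topology
open MeasureTheory Filter
open Literature.Probability.LatticeModels Literature.Probability.Percolation
open Summit.CriticalPhenomena.Ising3DConformalLimit.GapForcesFarMergingSandwich
open Summit.CriticalPhenomena.Ising3DConformalLimit.Theses.EnergyNotSigmaSquared
open Summit.CriticalPhenomena.Ising3DConformalLimit.EnergyNotSigmaSquaredGapForcesFarMerging
  (tendsto_isingTwoPoint_box_criticalCorr_two eventually_forall_mem_box_four)

/-- `merge n y` is the `P^{y₀y₁,y₂y₃}_{Λ_n}`-probability of the connection event `openConn y₀ y₂` of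
ADC21 (3.11): the merging event `{ω | y₂ ∈ C_ω(y₀)}` and `openConn y₀ y₂` are both
`{ω | (openGraph ω).Reachable y₀ y₂}`, definitionally. [cite: AizenmanDuminilCopinAnnals2021, eq. (3.11)] -/
theorem merge_eq_real_openConn (n : ℕ) (y : Fin 4 → Site 3) :
    merge n y = (sourcedDoubleCurrentLaw 3 n (criticalBeta 3) ({y 0} ∆ {y 1}) ({y 2} ∆ {y 3})).real
      (openConn (y 0) (y 2)) := rfl

/-- **Merging in the box**: if `z₀,…,z₃ ∈ Λ_n` and the two-current merging probability is `≥ c`, then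
`U₄^{Λ_n}(z) + 2c ⟨σ_{z₀}σ_{z₁}⟩_{Λ_n}⟨σ_{z₂}σ_{z₃}⟩_{Λ_n} ≤ 0` (ADC21 (3.11) in the box,
`connectedFour_free_box_eq`, and Griffiths I). [cite: AizenmanDuminilCopinAnnals2021, eq. (3.11)] -/
theorem connectedFour_box_add_le_zero_of_le_merge {c : ℝ} {n : ℕ} {z : Fin 4 → Site 3}
    (hz : ∀ i, z i ∈ box 3 n) (hm : c ≤ merge n z) :
    connectedFour (isingMeasure (zdGraph 3) (box 3 n) (criticalBeta 3) 0 .free) spinAt z +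
        2 * c * (isingTwoPoint (zdGraph 3) (box 3 n) (criticalBeta 3) 0 .free (z 0) (z 1) *
          isingTwoPoint (zdGraph 3) (box 3 n) (criticalBeta 3) 0 .free (z 2) (z 3)) ≤ 0 := by
  classical
  have hP : c ≤ (sourcedDoubleCurrentLaw 3 n (criticalBeta 3) ({z 0} ∆ {z 1}) ({z 2} ∆ {z 3})).real
      (openConn (z 0) (z 2)) := by
    rw [← merge_eq_real_openConn]
    exact hm
  have hz4 : z = ![z 0, z 1, z 2, z 3] := by funext i; fin_cases i <;> rfl
  have h4 := connectedFour_free_box_eq (d := 3) n (criticalBeta_nonneg 3) (hz 0) (hz 1) (hz 2) (hz 3)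
  rw [← hz4] at h4
  have hG01 : 0 ≤ isingTwoPoint (zdGraph 3) (box 3 n) (criticalBeta 3) 0 .free (z 0) (z 1) :=
    isingTwoPoint_free_nonneg (fun {_ _ _ _ _} => GKSInequalities.gks_one_holds (zdGraph 3))
      (criticalBeta_nonneg 3) (hz 0) (hz 1)
  have hG23 : 0 ≤ isingTwoPoint (zdGraph 3) (box 3 n) (criticalBeta 3) 0 .free (z 2) (z 3) :=
    isingTwoPoint_free_nonneg (fun {_ _ _ _ _} => GKSInequalities.gks_one_holds (zdGraph 3))
      (criticalBeta_nonneg 3) (hz 2) (hz 3)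
  have hGG := mul_le_mul_of_nonneg_left hP (mul_nonneg hG01 hG23)
  rw [h4]
  nlinarith [hGG]

/-- **The limit form**: if the two-current merging probability of `z` in `Λ_n` is `≥ c` for infinitely
many box sizes, then the critical Ursell function satisfies
`U₄(z) ≤ -2c ⟨σ_{z₀}σ_{z₁}⟩_{β_c}⟨σ_{z₂}σ_{z₃}⟩_{β_c}` (box limits of all terms; a convergent sequence
which is `≤ 0` frequently has limit `≤ 0`). [cite: AizenmanDuminilCopinAnnals2021, eq. (3.12)] -/
theorem criticalUrsellFour_le_of_frequently_le_merge {c : ℝ} (z : Fin 4 → Site 3)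
    (hfreq : ∃ᶠ n : ℕ in atTop, c ≤ merge n z) :
    criticalCorr 3 4 z - (criticalCorr 3 2 ![z 0, z 1] * criticalCorr 3 2 ![z 2, z 3]
        + criticalCorr 3 2 ![z 0, z 2] * criticalCorr 3 2 ![z 1, z 3]
        + criticalCorr 3 2 ![z 0, z 3] * criticalCorr 3 2 ![z 1, z 2]) ≤
      -(2 * c * (criticalCorr 3 2 ![z 0, z 1] * criticalCorr 3 2 ![z 2, z 3])) := by
  have hU := tendsto_connectedFour_box_criticalBeta (d := 3) le_rfl z
  have hlim := hU.add (((tendsto_isingTwoPoint_box_criticalCorr_two (z 0) (z 1)).mul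
    (tendsto_isingTwoPoint_box_criticalCorr_two (z 2) (z 3))).const_mul (2 * c))
  have hfreq' : ∃ᶠ n : ℕ in atTop,
      connectedFour (isingMeasure (zdGraph 3) (box 3 n) (criticalBeta 3) 0 .free) spinAt z +
        2 * c * (isingTwoPoint (zdGraph 3) (box 3 n) (criticalBeta 3) 0 .free (z 0) (z 1) *
          isingTwoPoint (zdGraph 3) (box 3 n) (criticalBeta 3) 0 .free (z 2) (z 3)) ≤ 0 := by
    refine (hfreq.and_eventually (eventually_forall_mem_box_four z)).mono ?_
    rintro n ⟨hn, hbox⟩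
    exact connectedFour_box_add_le_zero_of_le_merge hbox hn
  have hle := isClosed_Iic.mem_of_frequently_of_tendsto hfreq' hlim
  rw [Set.mem_Iic] at hle
  linarith

end FarMergingSpinsProof

open Summit.CriticalPhenomena.Ising3DConformalLimit.GapForcesFarMergingSandwich
open Summit.CriticalPhenomena.Ising3DConformalLimit.Theses.EnergyNotSigmaSquared

/-- **Far two-current merging is far merging** (the exact far end of the line): two-current merging
`P^{Ly₀Ly₁, Ly₂Ly₃}_{Λ_n}[Ly₀ ↔ Ly₂ in n₁+n₂] ≥ c` frequently in `n`, along dilations `L` of one injective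
shape `y` (`FarMergeIO`), gives Aizenman's far merging `U₄(Ly) ≤ -2c ⟨σσ⟩⟨σσ⟩` along the same dilations
(ADC21 (3.11) in the box + box limits), i.e. `FarMerging` with constant `2c`. [cite: AizenmanDuminilCopinAnnals2021, eq. (3.11)] -/
theorem stub_farMergingSpins : FarMergeIO → FarMerging := by
  rintro ⟨c, hc, y, hy, hfar⟩
  refine ⟨2 * c, by positivity, y, hy, fun L₀ => ?_⟩
  obtain ⟨L, hL, hfreq⟩ := hfar L₀
  exact ⟨L, hL,
    FarMergingSpinsProof.criticalUrsellFour_le_of_frequently_le_merge (fun i => (L : ℤ) • y i) hfreq⟩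

end Summit.CriticalPhenomena.Ising3DConformalLimit.EnergyNotSigmaSquaredGapForcesFarMergingSandwich

end
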